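import Summits.QuantumFields.YangMills.Theorems.ForcedResponseSkewnessResponseLocalisationContactOfFemto
import Summits.QuantumFields.YangMills.Theorems.ForcedResponseSkewnessRunningCouplingCeilingScaleFreePinnedOfMomentBounds6
import Summits.QuantumFields.YangMills.Theorems.LangevinControlUVOSLegsFromFemtoAndGapStubCollar6
import Summits.QuantumFields.YangMills.Theorems.LangevinControlUVOSLegsAtWeakCouplingCFblOfFbl6
import HarnessLib

/-!
# Route `ForcedResponseSkewness`: ONE femto engine stub for both cruxes — reductions from `FBL6PinnedSigR`

Helper file of the lead `ym-line-frs-p1` (g3), `--supports stmt-QuantumFields-24869`.  The spine's femto package is stated with the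
PLANE-RESOLVED frozen-boundary law `FBL6 G r a` (`Statement.stub_fcp6`); asked along a pinned unit (`FBL6PinnedSigR`,
`Theorems/ForcedResponseSkewnessResponseLocalisationDefs.lean`) it serves both cruxes of this route:

* `fblPinnedSigR_of_fbl6 : FBL6PinnedSigR → FBLPinnedSigR` (tree `fbl_of_fbl6`: the action density is the sum of the six plane
  fields) — the E0′ stub of line «femto-collar» on the deciding crux `ResponseLocalisation` (24869);
* `scaleFreeLocalPinnedSigR_of_fbl6 : FBL6PinnedSigR → ScaleFreeLocalPinnedSigR` (tree `stub_collar6 : FBL6 → MomentBounds6` and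
  `scaleFreeLocalPinnedSigR_of_momentBounds6`) — the E0′ stub of line «pointwise-log-ceiling-r» on `RunningCouplingCeiling` (24275);
* `contactKernel_of_fbl6 : FBL6PinnedSigR → NearCovLawSigR → ContactKernelSigR` (with the landed collar transfer
  `contactKernel_of_femto`).

So the route's physics debt outside the residual is exactly {`FBL6` along a pinned unit (the spine's femto engine, shared),
`NearCovLaw` (near-pair femto law, AF), `LogCeilingSigR` (AF log ceiling)}.  No summit is proved by any of this (leaf R2a
`BalabanLadder.NT`, conditional rung line; the YM mass gap is NOT proved).
-/

set_option autoImplicit false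

noncomputable section

namespace Summit.QuantumFields.YangMills.Cruxes.ResponseLocalisation.Femto

open MeasureTheory Filter Topology
open Literature.MathematicalPhysics.QuantumFieldTheory Literature.MathematicalPhysics.QuantumLattice
open Summit.QuantumFields.YangMills.Cruxes.OSLegsFromFemtoAndGap.DlrCollarTransfer
open Summit.QuantumFields.YangMills.Cruxes.RunningCouplingCeiling.Pointwise
open Summit.QuantumFields.YangMills.Cruxes.ResponseLocalisation.Birth

/-- **The pinned frozen-boundary law from its plane-resolved form** (tree `fbl_of_fbl6`). [folklore] -/
theorem fblPinnedSigR_of_fbl6 (h : FBL6PinnedSigR) : FBLPinnedSigR := by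
  intro G _ _ _ _ hG
  letI : MeasurableSpace G := borel G
  haveI : BorelSpace G := ⟨rfl⟩
  intro r a hpos hlim hpin
  exact fbl_of_fbl6 r a (h G hG r a hpos hlim hpin)

/-- **The pinned local scale-free ceiling (≡ `MomentBounds6` in the pinned unit) from the plane-resolved boundary law**
(tree `stub_collar6 : FBL6 → MomentBounds6` and `scaleFreeLocalPinnedSigR_of_momentBounds6`). [folklore] -/
theorem scaleFreeLocalPinnedSigR_of_fbl6 (h : FBL6PinnedSigR) : ScaleFreeLocalPinnedSigR := by
  refine scaleFreeLocalPinnedSigR_of_momentBounds6 ?_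
  intro G _ _ _ _ hG
  letI : MeasurableSpace G := borel G
  haveI : BorelSpace G := ⟨rfl⟩
  intro r a hpos hlim hpin
  exact stub_collar6 G r a (h G hG r a hpos hlim hpin)

/-- **The kernel-level contact ceiling from the plane-resolved boundary law and the near-pair law** (the landed collar
transfer `contactKernel_of_femto`). [folklore] -/
theorem contactKernel_of_fbl6 (h : FBL6PinnedSigR) (hNC : NearCovLawSigR) : ContactKernelSigR :=
  contactKernel_of_femto (fblPinnedSigR_of_fbl6 h) hNC

end Summit.QuantumFields.YangMills.Cruxes.ResponseLocalisation.Femto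

end
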